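import Summits.BirchSwinnertonDyer.BirchSwinnertonDyer.Theorems.SignedLowerHalvesSprungLowerDivisibilityAtThreeSqueezeToCommonZerosContra
import Summits.BirchSwinnertonDyer.BirchSwinnertonDyer.Theorems.SignedLowerHalvesSprungLowerDivisibilityAtThreeCyclotomicLowerAtT
import Literature.NumberTheory.EllipticCurves.IwasawaAlgebraInvolutionFixedPrimesProofs
import HarnessLib

/-!
# Crux `SprungLowerDivisibilityAtThree` (K1, item stmt-BirchSwinnertonDyer-19875), line `chromatic-common-zeros` — SECOND C′ BRICK:
# door (R3′)-contra — the PRINT-FAITHFUL Eisenstein half C′ for a colour `•` on an X8 pair of analytic rank `≤ 1` whose Sprung pair has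
# NO COMMON ZERO OFF `(T)` and whose colour `•` has a SIMPLE zero at `T` when `r_an = 1` (the census's rank-one certificate `λ(L^•) = 1`)

LEAD seat `cruxlead-stmt-BirchSwinnertonDyer-19875` gen 6 (prover; host `pub/bsd-ssimc`), 2026-08-28. `--supports` 19875 `--as helper`; THEOREMS
ONLY; route-independent imports. Sequel of `…SqueezeToCommonZerosContra` (p668614: (R0)-contra needs coprimality at EVERY height-one prime,
which fails at `(T)` on rank-one pairs — both colours vanish at `T = 0`). Closes NOTHING; the conclusion is the repaired leaf text C′ (LHS of
`ChromaticKeying.sprungSharpFlatLowerDivisibility_contra_iff_invol`), for which no item exists yet. **BSD is NOT proved; K1 / C′ NOT proved.**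

## What

`sprungSharpFlatLowerDivisibilityContra_of_noCommonZeroOffT_of_order`: on an X8 pair with `r_an ≤ 1`, if (per newform/period/pair instance)
no height-one prime OTHER than `(T)` is a common zero of the normalised colours, and — when `r_an = 1` — the colour `•` under study has
`ord_T L^• = 1` (census: `(μ, λ)(L^•) = (0, 1)` at a rank-one cell; Kobayashi 2013 Cor. 1.3 (i) gives this for SOME colour), then the C′ leaf
text holds for `•`, modulo Sprung Thm. 7.14 (`h714`), the period unit (`h3`), the γ⁻¹-keyed joint package (`hJc`), and Gross–Zagier–Kolyvagin
(`hGZK`: rank = analytic rank ≤ 1). The prime `(T)` is handled WITHOUT the Coleman–Kato package and WITHOUT a colour transfer: at `r_an = 0` a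
normalised colour has non-zero constant term (`ChromaticCommonZerosRankZero.normalised_notMem_of_X_mem`), so `(T)` is not a common zero; at
`r_an = 1`, `ℓ_{(T)} Λ/(G^•) = 1` (`lengthAt_quotient_normalised_eq_one_of_order_eq_one`) while `1 ≤ ℓ_{(T)} D′.X` — control for a γ-KEYED
datum `D₀` of the same colour (`one_le_lengthAt_of_not_finite_coinvariants` + Sprung 2024 Lemma 5.6 `lem56AllN_…` + GZK: `Sel_{p^∞}(E/ℚ)`
infinite) TRANSPORTED to the contragredient `D′` at the ι-FIXED prime `(T)` by the dictionary
(`sharpFlatSelmerDualData_lengthAt_primeT_inv_eq`, p663468: lengths at `(T)` are keying-immune). Off `(T)` the squeeze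
`squeezeToCommonZeros_contra` runs on the certificate exactly as in (R0)-contra. Same-colour order datum ⟹ no `lengthAt_quotient_le_of_otherColour`
twin is needed (that transfer is the one remaining C′ port for the two-colour (R3)).

References: Sprung, JNT 132 (2012) Def. 6.1, Thm. 7.14 with (3), Prop. 7.19, Main Conj. 7.21 [Sprung2012]; Sprung 2024 §5.2 Lemma 5.6
[Sprung2024]; Kobayashi 2013 Cor. 1.3 (i) [Kobayashi2013]; Greenberg, LNM 1716 §4 Lemma 4.2 [GreenbergLNM1716]; Gross–Zagier 1986 /
Kolyvagin 1990 [GrossZagier1986, Kolyvagin1990]; Washington GTM 83 §13.2 [Washington1997].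
-/

set_option linter.dupNamespace false
set_option autoImplicit false

noncomputable section

open scoped Classical NumberField MatrixGroups ModularForm

open NumberField IsDedekindDomain CongruenceSubgroup WeierstrassCurve Field
  Literature.NumberTheory.EllipticCurves Literature.NumberTheory.EllipticCurves.ModularForms
  Literature.NumberTheory.EllipticCurves.ZpExtension Literature.NumberTheory.EllipticCurves.Sprung2017
  Literature.NumberTheory.EllipticCurves.Sprung2012 Literature.NumberTheory.EllipticCurves.Rank1Residual
  Literature.NumberTheory.EllipticCurves.IwasawaAlgebra Literature.NumberTheory.EllipticCurves.Kato2004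
  Summit.BirchSwinnertonDyer.BirchSwinnertonDyer.Theorems
  Summit.BirchSwinnertonDyer.Rank1Residual.Supersingular

namespace Summit.BirchSwinnertonDyer.BirchSwinnertonDyer.Theorems.ChromaticCommonZeros

/-- **(R3′)-contra: NO common zero OFF `(T)`, `r_an ≤ 1`, and a simple `T`-zero of the colour `•` at `r_an = 1` ⟹ the PRINT-FAITHFUL
Eisenstein half C′ for `•`, per pair.** Hypotheses BY NAME: Sprung 2012 Thm. 7.14 (`h714`), the period unit at `3` (`h3`), the γ⁻¹-keyed joint
Coleman–Kato package (`hJc = thm714seq_sharpFlatColemanKato_zetaJoint_contra`), Gross–Zagier–Kolyvagin (`hGZK`); per-pair DATA: X8, `r_an ≤ 1`,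
«no height-one prime `𝔭 ∌ T` contains every normalised colour» (verbatim the datum of the γ-keyed (R3)), and «`r_an = 1 ⟹ ord_T L^• = 1`» for
the colour `•` itself. Conclusion: for every instance of the leaf's binders and every CONTRAGREDIENT dual datum `D′` of `Sel^•`,
`char D′.X = (gen)`, `gen^ℚ = ϖ·(L^•·h)^ℚ` (Main Conj. 7.21 ⊆ as printed, ϖ-normalised). [cite: Sprung2012, Thm. 7.14 (3) (p. 1504), Prop.
7.19 and Main Conj. 7.21 (p. 1505)] [cite: Sprung2024, §5.2 Lemma 5.6 (p. 41)] [cite: GreenbergLNM1716, §4 Lemma 4.2 (p. 102)]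
[cite: GrossZagier1986, Thm. (7.3)] [cite: Kolyvagin1990, Thm. A] [cite: Washington1997, §13.2] -/
theorem sprungSharpFlatLowerDivisibilityContra_of_noCommonZeroOffT_of_order
    (W : WeierstrassCurve ℚ) [W.IsElliptic] [W.IsGloballyMinimal] (p : ℕ) [Fact p.Prime]
    (h714 : thm714_sharpFlatSelmerDual_finite_torsion)
    (h3 : realPeriodRat_eq_unit_mul_plusPeriod_three)
    (hJc : thm714seq_sharpFlatColemanKato_zetaJoint_contra)
    (hGZK : rank_eq_analyticRank_of_analyticRank_le_one)
    (hX : ClassX8 W p) (hr : W.analyticRank ≤ 1) (col : Chroma)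
    (hnc : ∀ {N : ℕ} [NeZero N] (f : CuspForm (Gamma0 N) 2) (ϖ : ℚ) (Lsharp Lflat : IwasawaAlgebra p),
      IsNewformOf W f → (ϖ : ℝ) * W.realPeriodRat = plusPeriod f →
      IsSprungPair f p (W.frobeniusTrace p) Lsharp Lflat →
      ∀ 𝔭 : PrimeSpectrum (IwasawaAlgebra p), 𝔭.asIdeal.height = 1 →
        (PowerSeries.X : IwasawaAlgebra p) ∉ 𝔭.asIdeal →
        ∃ (col' : Chroma) (G' : IwasawaAlgebra p),
          iwasawaToPowerSeries p G' =
            PowerSeries.C (ϖ : ℚ_[p]) * iwasawaToPowerSeries p (chromaticL col' Lsharp Lflat) ∧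
          G' ∉ 𝔭.asIdeal)
    (hord : W.analyticRank = 1 → ∀ {N : ℕ} [NeZero N] (f : CuspForm (Gamma0 N) 2) (Lsharp Lflat : IwasawaAlgebra p),
      IsNewformOf W f → IsSprungPair f p (W.frobeniusTrace p) Lsharp Lflat →
        PowerSeries.order (chromaticL col Lsharp Lflat) = 1) :
    ∀ (κ : ZpExtension ℚ p) (γ : Field.absoluteGaloisGroup ℚ),
        κ.IsCyclotomic → κ.IsTopGenerator γ → IsCyclotomicVariable p γ →
      ∀ (v : HeightOneSpectrum (𝓞 ℚ)), (p : 𝓞 ℚ) ∈ v.asIdeal →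
      ∀ (g : Field.absoluteGaloisGroup (v.adicCompletion ℚ)),
        κ.IsTopGenerator (resGalOfEmb (closureEmb (K := ℚ) (v.adicCompletion ℚ)) g) →
      ∀ (cneg : localPoints W (v.adicCompletion ℚ)) (c : ℕ → localPoints W (v.adicCompletion ℚ)),
        IsHondaSystem κ (closureEmb (K := ℚ) (v.adicCompletion ℚ)) W (W.frobeniusTrace p) g cneg c →
      ∀ (N : ℕ) (_ : NeZero N) (f : CuspForm (Gamma0 N) 2) (ϖ : ℚ) (Lsharp Lflat : IwasawaAlgebra p),
        IsNewformOf W f → (ϖ : ℝ) * W.realPeriodRat = plusPeriod f →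
        IsSprungPair f p (W.frobeniusTrace p) Lsharp Lflat → chromaticL col Lsharp Lflat ≠ 0 →
      ∀ D' : SharpFlatSelmerDualData W κ γ⁻¹ (closureEmb (K := ℚ) (v.adicCompletion ℚ))
          (W.frobeniusTrace p) g c col,
        ∃ gen h : IwasawaAlgebra p, D'.charIdeal = Ideal.span {gen} ∧
          iwasawaToPowerSeries p gen =
            PowerSeries.C (ϖ : ℚ_[p]) * iwasawaToPowerSeries p (chromaticL col Lsharp Lflat * h) := by
  intro κ γ hκ hγ hcv v hv g hg cneg c hH N hN f ϖ Lsharp Lflat hf hϖ hSP hcol D'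
  classical
  haveI : NeZero N := hN
  obtain ⟨hp3, ⟨hgood, hap⟩, -⟩ := id hX
  subst hp3
  haveI : ContinuousSMul ℤ_[3] (W.tateModule 3) := TateModule.continuousSMul_padicInt
  haveI : Module.Free ℤ_[3] (W.tateModule 3) := W.module_free_tateModule_holds 3
  haveI : Module.Finite ℤ_[3] (W.tateModule 3) := W.module_finite_tateModule_holds 3
  have hp2 : (3 : ℕ) ≠ 2 := by decide
  -- Thm. 7.14 (keying-immune) transported to the contragredient datum through a γ-keyed one of the same colour
  obtain ⟨D₀⟩ := nonempty_sharpFlatSelmerDualData_rat W κ γ v g c col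
  obtain ⟨hfin₀, htor₀⟩ :=
    h714 W 3 hp2 hgood hap f hf κ γ hκ hγ hcv v hv g hg cneg c hH col Lsharp Lflat hSP hcol D₀
  haveI := hfin₀
  haveI : Module.Finite (IwasawaAlgebra 3) D'.X := (sharpFlatSelmerDualData_finite_inv_iff D₀ D').1 hfin₀
  have htorD : Module.IsTorsion (IwasawaAlgebra 3) D'.X := (sharpFlatSelmerDualData_isTorsion_inv_iff D₀ D').1 htor₀
  -- the pinned covariant `𝐇¹` and the print-keyed joint package
  obtain ⟨I⟩ := Kato2004.nonempty_iwasawaH1Data_holds W 3 κ γ hκ hγ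
  obtain ⟨Cs, Cf, hZ⟩ := hJc W 3 f ϖ κ γ hp2 hgood hap hf hϖ hκ hγ hcv v hv g hg cneg c hH I
  -- the Néron-normalised `G = C(u)·L^•`, `u = ϖ ∈ ℤ₃ˣ`
  have hϖ1 : ‖(ϖ : ℚ_[3])‖ = 1 := norm_periodRatio_eq_one_of_classX8 h3 W 3 hX f hf ϖ hϖ
  set u : ℤ_[3]ˣ := PadicInt.mkUnits hϖ1 with hu
  set G : IwasawaAlgebra 3 := PowerSeries.C (u : ℤ_[3]) * chromaticL col Lsharp Lflat with hGdef
  have hG : iwasawaToPowerSeries 3 G =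
      PowerSeries.C (ϖ : ℚ_[3]) * iwasawaToPowerSeries 3 (chromaticL col Lsharp Lflat) := by
    rw [hGdef, (span_C_units_mul_eq u (chromaticL col Lsharp Lflat)).2, hu, PadicInt.mkUnits_eq]
  refine squeezeToCommonZeros_contra W 3 hX col κ γ hκ hγ hcv v hv g hg cneg c hH N hN f ϖ Lsharp Lflat hf
    hϖ hSP hcol D' htorD G hG I Cs Cf hZ ?_
  intro 𝔭 h𝔭 hcommon
  by_cases hT : (PowerSeries.X : IwasawaAlgebra 3) ∈ 𝔭.asIdeal
  · -- `𝔭 = (T)`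
    rcases Nat.lt_or_ge W.analyticRank 1 with hr0 | hr1
    · -- `r_an = 0`: `(T)` is not a common zero
      have h0 : W.analyticRank = 0 := by omega
      exact absurd (hcommon col G hG)
        (ChromaticCommonZerosRankZero.normalised_notMem_of_X_mem W 3 hX h0 hf hϖ hSP col hG 𝔭 h𝔭 hT)
    · -- `r_an = 1`: `ℓ_{(T)} Λ/(G) = 1 ≤ ℓ_{(T)} D′.X` by control, transported across the keying at the ι-fixed prime `(T)`
      have h1 : W.analyticRank = 1 := le_antisymm hr hr1
      have hlen : Module.lengthAt (IwasawaAlgebra 3) (IwasawaAlgebra 3 ⧸ Ideal.span {G}) 𝔭 = 1 :=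
        lengthAt_quotient_normalised_eq_one_of_order_eq_one u (hord h1 f Lsharp Lflat hf hSP) 𝔭 h𝔭 hT
      have hSel : ¬ Finite (W.selmerGroupPInfty 3) := K1RankOne.not_finite_selmer_of_analyticRank_eq_one hGZK W h1
      have hinf₀ : ¬ Finite (coinvariants 3 D₀.X) := fun hfin =>
        hSel (Sprung2024.lem56AllN_sharpFlat_finite_selmer_of_finite_coinvariants_holds W 3 hp2 hgood hap κ γ hκ hγ
          hcv v hv g hg cneg c hH col D₀ hfin)
      have h1le₀ : 1 ≤ Module.lengthAt (IwasawaAlgebra 3) D₀.X 𝔭 :=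
        one_le_lengthAt_of_not_finite_coinvariants D₀.X htor₀ hinf₀ 𝔭 h𝔭 hT
      have h𝔭T : 𝔭 = primeT 3 :=
        PrimeSpectrum.ext ((Ideal.eq_span_singleton_of_height_eq_one h𝔭 hT PowerSeries.X_prime).trans
          (primeT_asIdeal 3).symm)
      have htrans : Module.lengthAt (IwasawaAlgebra 3) D'.X 𝔭 = Module.lengthAt (IwasawaAlgebra 3) D₀.X 𝔭 := by
        rw [h𝔭T]; exact sharpFlatSelmerDualData_lengthAt_primeT_inv_eq D₀ D'
      rw [hlen, htrans]
      exact h1le₀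
  · -- off `T` there is no common zero (the certificate)
    obtain ⟨col', G', hG', hG'𝔭⟩ := hnc f ϖ Lsharp Lflat hf hϖ hSP 𝔭 h𝔭 hT
    exact absurd (hcommon col' G' hG') hG'𝔭

end Summit.BirchSwinnertonDyer.BirchSwinnertonDyer.Theorems.ChromaticCommonZeros

end
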